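import Summits.AtomisticToContinuum.Crystallization.Theorems.ChessboardParticlePlanesPeriodicWindowsLevelRegistryA

/-!
# Crux `PeriodicWindows` (stmt-AtomisticToContinuum-3240), line `Sketch` — stub `stub_levelRegistry`

Stub E0b2 of the lead skeleton `PeriodicWindowsSketch` (exact inter-level rigidity). Setting:
`X ⊆ ℝ³`, heights `· 2` pairwise equal or `≥ 19/25` apart, every level `{q ∈ X | q 2 = p 2}` a
triangular lattice `p + ℤu' + ℤv'` of spacing `a ∈ [19/20, 1]` (horizontal frame depending on the
level), and every point with three points of `X` at distance `b ∈ [19/20, 1]` on one height above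
and three on one height below. Conclusion, for the level of `p` with frame `(u, v)`: the levels at
heights `p 2 ± h`, `h = √(b² − a²/3)`, are `p ± h e₃ + σ(u + v)/3 + ℤu + ℤv` with signs
`σ, τ = ±1`, and no height of `X` lies strictly within `h` of `p 2` except `p 2`.

Proof (part A holds the frame algebra, the finite checks and the small-circle lemma).
* B1. Lattice bookkeeping: re-basing `t + ℤe + ℤf` at one of its points, invariance under a
  unimodular change of frame, and `‖u‖ = a ∧ 3u ∈ ℤe + ℤf ⇒ u ∈ ℤe + ℤf`.
* B2. For `y ∈ X` the three points above (or below) `y` lie in one level lattice (frame at one of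
  them) on a circle of squared radius `b² − g² ≤ 1 − (19/25)²`, so (part A) they form a unit
  triangle with centroid `y ± g e₃` and `g = h`.
* B3. Apply B2 at `p`, `p + u`, `p + v`: three unit triangles of the level `L` at height
  `p 2 ± h`, whose frame at `t₁` is `(e, f)`. Differences of centroids give `3u, 3v ∈ ℤe + ℤf`,
  hence `u, v ∈ ℤe + ℤf` are unit vectors with `⟪u, v⟫ = a²/2`: a unimodular pair, so
  `L = t₁ + ℤu + ℤv`; the centroid `p ± h e₃ = t₁ + (m e + n f)/3` has `m ≡ n ≢ 0 (mod 3)` and the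
  coordinate sums of `(u, v)` are `≡ (r, r)`, `r ≢ 0`, so `p ± h e₃ + σ(u + v)/3 ∈ L` for a sign
  `σ`.
* Main. `s = 1` with the up-data and `s = -1` with the down-data; finally a height of `X` within
  `h` of `p 2` but different from it is `≥ 19/25` away (gap hypothesis), hence within
  `h − 19/25 < 19/25` of the level at `p 2 ± h`, contradicting the gap hypothesis there.
-/

noncomputable section

namespace Summit.AtomisticToContinuum.Crystallization.Theorems.PeriodicWindowsSketch

/-! ## Part B1: lattice bookkeeping -/

/-- Re-basing a level lattice `t + ℤe + ℤf` at one of its points `o`. -/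
theorem lreg_rebase {t o e f : EuclideanSpace ℝ (Fin 3)} {i₀ j₀ : ℤ}
    (ho : o = t + (i₀ : ℝ) • e + (j₀ : ℝ) • f) :
    {q : EuclideanSpace ℝ (Fin 3) | ∃ i j : ℤ, q = t + (i : ℝ) • e + (j : ℝ) • f} =
      {q | ∃ i j : ℤ, q = o + (i : ℝ) • e + (j : ℝ) • f} := by
  ext q
  simp only [Set.mem_setOf_eq]
  constructor
  · rintro ⟨i, j, rfl⟩
    exact ⟨i - i₀, j - j₀, by rw [ho]; push_cast; module⟩
  · rintro ⟨i, j, rfl⟩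
    exact ⟨i + i₀, j + j₀, by rw [ho]; push_cast; module⟩

/-- A unimodular integer change of frame does not change the lattice: if `u = Ie + Jf`,
`v = I'e + J'f` with `IJ' − JI' = ±1` then `o + ℤe + ℤf = o + ℤu + ℤv`. -/
theorem lreg_unimodular {o e f u v : EuclideanSpace ℝ (Fin 3)} {I J I' J' : ℤ}
    (hu : u = (I : ℝ) • e + (J : ℝ) • f) (hv : v = (I' : ℝ) • e + (J' : ℝ) • f)
    (hdet : I * J' - J * I' = 1 ∨ I * J' - J * I' = -1) :
    {q : EuclideanSpace ℝ (Fin 3) | ∃ i j : ℤ, q = o + (i : ℝ) • e + (j : ℝ) • f} =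
      {q | ∃ i j : ℤ, q = o + (i : ℝ) • u + (j : ℝ) • v} := by
  obtain ⟨D, hD⟩ : ∃ D : ℤ, D * (I * J' - J * I') = 1 := by
    rcases hdet with h | h
    · exact ⟨1, by rw [h]; norm_num⟩
    · exact ⟨-1, by rw [h]; norm_num⟩
  have hDR : (D : ℝ) * ((I : ℝ) * J' - J * I') = 1 := by exact_mod_cast hD
  have he' : e = ((D * J' : ℤ) : ℝ) • u + ((-(D * J) : ℤ) : ℝ) • v := by
    rw [hu, hv]; push_cast
    match_scalars <;> first | ring1 | linear_combination -hDR
  have hf' : f = ((-(D * I') : ℤ) : ℝ) • u + ((D * I : ℤ) : ℝ) • v := by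
    rw [hu, hv]; push_cast
    match_scalars <;> first | ring1 | linear_combination -hDR
  ext q
  simp only [Set.mem_setOf_eq]
  constructor
  · rintro ⟨i, j, rfl⟩
    refine ⟨i * (D * J') + j * (-(D * I')), i * (-(D * J)) + j * (D * I), ?_⟩
    rw [he', hf']; push_cast; module
  · rintro ⟨i, j, rfl⟩
    refine ⟨i * I + j * I', i * J + j * J', ?_⟩
    rw [hu, hv]; push_cast; module

/-- A vector `u` of norm `a` with `3u` in the frame lattice lies in the frame lattice
(`M² + MN + N² = 9` forces `3 ∣ M, N`). -/
theorem lreg_third {a : ℝ} (ha : 0 < a) {e f u : EuclideanSpace ℝ (Fin 3)} (he : ‖e‖ = a)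
    (hf : ‖f‖ = a) (hef : inner ℝ e f = a ^ 2 / 2) (hu : ‖u‖ = a) {M N : ℤ}
    (h3 : (3 : ℝ) • u = (M : ℝ) • e + (N : ℝ) • f) :
    ∃ I J : ℤ, u = (I : ℝ) • e + (J : ℝ) • f := by
  have h9 : M ^ 2 + M * N + N ^ 2 = 9 := by
    have h1 := lreg_norm_sq_comb he hf hef (M : ℝ) (N : ℝ)
    rw [← h3, norm_smul, mul_pow, hu, Real.norm_eq_abs, abs_of_pos (by norm_num : (0 : ℝ) < 3)]
      at h1
    have h2 : a ^ 2 * ((M : ℝ) ^ 2 + M * N + (N : ℝ) ^ 2) = a ^ 2 * 9 := by rw [← h1]; ring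
    have h4 : ((M : ℝ) ^ 2 + M * N + (N : ℝ) ^ 2) = 9 := mul_left_cancel₀ (pow_ne_zero 2 ha.ne') h2
    exact_mod_cast h4
  obtain ⟨hM, hN⟩ := lreg_nine h9
  refine ⟨M / 3, N / 3, ?_⟩
  have hM' : (M : ℝ) = 3 * ((M / 3 : ℤ) : ℝ) := by exact_mod_cast (by omega : M = 3 * (M / 3))
  have hN' : (N : ℝ) = 3 * ((N / 3 : ℤ) : ℝ) := by exact_mod_cast (by omega : N = 3 * (N / 3))
  rw [hM', hN'] at h3
  linear_combination (norm := module) (1 / 3 : ℝ) • h3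

/-! ## Part B2: the unit triangle above/below a point of `X` -/

/-- The three points of `X` at distance `b` on the next level above (`s = 1`) or below
(`s = -1`) a point `y ∈ X` form a unit triangle of the level lattice with centroid `y ± h e₃`,
`h = √(b² − a²/3)`; in particular the gap is exactly `h`. -/
theorem lreg_triangle_at {X : Set (EuclideanSpace ℝ (Fin 3))} {a b s : ℝ} (ha1 : 19 / 20 ≤ a)
    (hb2 : b ≤ 1) (hs : s = 1 ∨ s = -1)
    (hgap : ∀ p ∈ X, ∀ q ∈ X, q 2 = p 2 ∨ 19 / 25 ≤ |q 2 - p 2|)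
    (hlat : ∀ p ∈ X, ∃ u v : EuclideanSpace ℝ (Fin 3), u 2 = 0 ∧ v 2 = 0 ∧ ‖u‖ = a ∧ ‖v‖ = a ∧
      inner ℝ u v = a ^ 2 / 2 ∧
      {q ∈ X | q 2 = p 2} = {q | ∃ i j : ℤ, q = p + (i : ℝ) • u + (j : ℝ) • v})
    (hud : ∀ p ∈ X, ∃ g : ℝ, 0 < g ∧ ∃ F : Finset (EuclideanSpace ℝ (Fin 3)), F.card = 3 ∧
      ∀ q ∈ F, q ∈ X ∧ q 2 = p 2 + s * g ∧ dist p q = b)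
    {y : EuclideanSpace ℝ (Fin 3)} (hy : y ∈ X) :
    ∃ t₁ t₂ t₃ : EuclideanSpace ℝ (Fin 3), (t₁ ∈ X ∧ t₂ ∈ X ∧ t₃ ∈ X) ∧
      (t₁ 2 = y 2 + s * Real.sqrt (b ^ 2 - a ^ 2 / 3) ∧
        t₂ 2 = y 2 + s * Real.sqrt (b ^ 2 - a ^ 2 / 3) ∧
        t₃ 2 = y 2 + s * Real.sqrt (b ^ 2 - a ^ 2 / 3)) ∧
      (dist t₁ t₂ = a ∧ dist t₁ t₃ = a ∧ dist t₂ t₃ = a) ∧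
      t₁ + t₂ + t₃ = (3 : ℝ) • y +
        (3 * (s * Real.sqrt (b ^ 2 - a ^ 2 / 3))) • EuclideanSpace.single (2 : Fin 3) (1 : ℝ) := by
  obtain ⟨g, hg, F, hF, hFq⟩ := hud y hy
  obtain ⟨t₁, t₂, t₃, h₁₂, h₁₃, h₂₃, rfl⟩ := Finset.card_eq_three.1 hF
  obtain ⟨ht₁X, ht₁, hd₁⟩ := hFq t₁ (by simp)
  obtain ⟨ht₂X, ht₂, hd₂⟩ := hFq t₂ (by simp)
  obtain ⟨ht₃X, ht₃, hd₃⟩ := hFq t₃ (by simp)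
  have hs1 : s ^ 2 = 1 := by rcases hs with rfl | rfl <;> norm_num
  have hsg : 19 / 25 ≤ |s * g| := by
    rcases hgap y hy t₁ ht₁X with h | h
    · exfalso
      rw [ht₁] at h
      have h0 : s * g = 0 := by linarith
      rcases hs with rfl | rfl <;> linarith
    · rwa [ht₁, add_sub_cancel_left] at h
  obtain ⟨e, f, -, -, he, hf, hef, hL⟩ := hlat t₁ ht₁X
  have ht₂L : t₂ ∈ {q ∈ X | q 2 = t₁ 2} := ⟨ht₂X, by rw [ht₂, ht₁]⟩
  have ht₃L : t₃ ∈ {q ∈ X | q 2 = t₁ 2} := ⟨ht₃X, by rw [ht₃, ht₁]⟩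
  rw [hL] at ht₂L ht₃L
  obtain ⟨i₂, j₂, ht₂e⟩ := ht₂L
  obtain ⟨i₃, j₃, ht₃e⟩ := ht₃L
  obtain ⟨-, hdist, hsq, hcen⟩ :=
    lreg_triangle ha1 hb2 hsg he hf hef ht₁ ht₂ ht₃ hd₁ hd₂ hd₃ h₁₂ h₁₃ h₂₃ ht₂e ht₃e
  have hg' : g = Real.sqrt (b ^ 2 - a ^ 2 / 3) := by
    have h2 : g ^ 2 = b ^ 2 - a ^ 2 / 3 := by rw [← hsq, mul_pow, hs1, one_mul]
    rw [← h2, Real.sqrt_sq hg.le]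
  subst hg'
  exact ⟨t₁, t₂, t₃, ⟨ht₁X, ht₂X, ht₃X⟩, ⟨ht₁, ht₂, ht₃⟩, hdist, hcen⟩

/-! ## Part B3: the level above/below is the expected translate of `ℤu + ℤv` -/

/-- **Registry of one neighbouring level.** With the frame `(u, v)` of the level of `p`, the
level at signed height `s h` (`s = ±1`, `h = √(b² − a²/3)`) is `p + s h e₃ + σ (u + v)/3 + ℤu + ℤv`
for a sign `σ`. -/
theorem lreg_level {X : Set (EuclideanSpace ℝ (Fin 3))} {a b s : ℝ} (ha1 : 19 / 20 ≤ a)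
    (hb2 : b ≤ 1) (hs : s = 1 ∨ s = -1)
    (hgap : ∀ p ∈ X, ∀ q ∈ X, q 2 = p 2 ∨ 19 / 25 ≤ |q 2 - p 2|)
    (hlat : ∀ p ∈ X, ∃ u v : EuclideanSpace ℝ (Fin 3), u 2 = 0 ∧ v 2 = 0 ∧ ‖u‖ = a ∧ ‖v‖ = a ∧
      inner ℝ u v = a ^ 2 / 2 ∧
      {q ∈ X | q 2 = p 2} = {q | ∃ i j : ℤ, q = p + (i : ℝ) • u + (j : ℝ) • v})
    (hud : ∀ p ∈ X, ∃ g : ℝ, 0 < g ∧ ∃ F : Finset (EuclideanSpace ℝ (Fin 3)), F.card = 3 ∧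
      ∀ q ∈ F, q ∈ X ∧ q 2 = p 2 + s * g ∧ dist p q = b)
    {p u v : EuclideanSpace ℝ (Fin 3)} (hp : p ∈ X) (hu2 : u 2 = 0) (hv2 : v 2 = 0)
    (hu : ‖u‖ = a) (hv : ‖v‖ = a) (huv : inner ℝ u v = a ^ 2 / 2)
    (hlev : {q ∈ X | q 2 = p 2} = {q | ∃ i j : ℤ, q = p + (i : ℝ) • u + (j : ℝ) • v}) :
    ∃ σ : ℝ, (σ = 1 ∨ σ = -1) ∧
      {q ∈ X | q 2 = p 2 + s * Real.sqrt (b ^ 2 - a ^ 2 / 3)} =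
        {q | ∃ i j : ℤ, q = p + (s * Real.sqrt (b ^ 2 - a ^ 2 / 3)) •
          EuclideanSpace.single (2 : Fin 3) (1 : ℝ) + σ • ((1 / 3 : ℝ) • (u + v)) +
          (i : ℝ) • u + (j : ℝ) • v} := by
  have ha : 0 < a := by linarith
  have hpu : p + u ∈ X := by
    have h1 : p + u ∈ {q | ∃ i j : ℤ, q = p + (i : ℝ) • u + (j : ℝ) • v} := ⟨1, 0, by simp⟩
    rw [← hlev] at h1
    exact h1.1
  have hpv : p + v ∈ X := by
    have h1 : p + v ∈ {q | ∃ i j : ℤ, q = p + (i : ℝ) • u + (j : ℝ) • v} := ⟨0, 1, by simp⟩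
    rw [← hlev] at h1
    exact h1.1
  obtain ⟨t₁, t₂, t₃, ⟨h₁X, h₂X, h₃X⟩, ⟨h₁, h₂, h₃⟩, ⟨d₁₂, d₁₃, d₂₃⟩, C1⟩ :=
    lreg_triangle_at ha1 hb2 hs hgap hlat hud hp
  obtain ⟨t₄, t₅, t₆, ⟨h₄X, h₅X, h₆X⟩, ⟨h₄, h₅, h₆⟩, -, C2⟩ :=
    lreg_triangle_at ha1 hb2 hs hgap hlat hud hpu
  obtain ⟨t₇, t₈, t₉, ⟨h₇X, h₈X, h₉X⟩, ⟨h₇, h₈, h₉⟩, -, C3⟩ :=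
    lreg_triangle_at ha1 hb2 hs hgap hlat hud hpv
  set H := s * Real.sqrt (b ^ 2 - a ^ 2 / 3) with hH
  simp only [PiLp.add_apply, hu2, hv2, add_zero] at h₄ h₅ h₆ h₇ h₈ h₉
  -- the frame of the upper level at `t₁`, and frame coordinates of `t₂, …, t₉`
  obtain ⟨e, f, -, -, he, hf, hef, hL⟩ := hlat t₁ h₁X
  have mem : ∀ t, t ∈ X → t 2 = p 2 + H →
      ∃ i j : ℤ, t = t₁ + (i : ℝ) • e + (j : ℝ) • f := fun t htX ht => by
    have h0 : t ∈ {q ∈ X | q 2 = t₁ 2} := ⟨htX, by rw [ht, h₁]⟩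
    rw [hL] at h0
    exact h0
  obtain ⟨i₂, j₂, ht₂⟩ := mem t₂ h₂X h₂
  obtain ⟨i₃, j₃, ht₃⟩ := mem t₃ h₃X h₃
  obtain ⟨i₄, j₄, ht₄⟩ := mem t₄ h₄X h₄
  obtain ⟨i₅, j₅, ht₅⟩ := mem t₅ h₅X h₅
  obtain ⟨i₆, j₆, ht₆⟩ := mem t₆ h₆X h₆
  obtain ⟨i₇, j₇, ht₇⟩ := mem t₇ h₇X h₇
  obtain ⟨i₈, j₈, ht₈⟩ := mem t₈ h₈X h₈
  obtain ⟨i₉, j₉, ht₉⟩ := mem t₉ h₉X h₉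
  -- the triangle above `p` is a unit triangle: its centroid class
  have n₂ := lreg_form_of_dist ha he hf hef ht₂ d₁₂
  have n₃ := lreg_form_of_dist ha he hf hef ht₃ d₁₃
  have ht₃' : t₃ = t₂ + ((i₃ - i₂ : ℤ) : ℝ) • e + ((j₃ - j₂ : ℤ) : ℝ) • f := by
    rw [ht₃, ht₂]; push_cast; module
  have n₂₃ := lreg_form_of_dist ha he hf hef ht₃' d₂₃
  obtain ⟨hmn, hm0⟩ := lreg_centroid_class n₂ n₃ n₂₃
  -- `u` and `v` are unit vectors of the upper frame lattice
  have h3u : (3 : ℝ) • u = ((i₄ + i₅ + i₆ - i₂ - i₃ : ℤ) : ℝ) • e +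
      ((j₄ + j₅ + j₆ - j₂ - j₃ : ℤ) : ℝ) • f := by
    push_cast
    linear_combination (norm := module) C1 - C2 + ht₄ + ht₅ + ht₆ - ht₂ - ht₃
  have h3v : (3 : ℝ) • v = ((i₇ + i₈ + i₉ - i₂ - i₃ : ℤ) : ℝ) • e +
      ((j₇ + j₈ + j₉ - j₂ - j₃ : ℤ) : ℝ) • f := by
    push_cast
    linear_combination (norm := module) C1 - C3 + ht₇ + ht₈ + ht₉ - ht₂ - ht₃
  obtain ⟨I, J, huIJ⟩ := lreg_third ha he hf hef hu h3u
  obtain ⟨I', J', hvIJ⟩ := lreg_third ha he hf hef hv h3v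
  have nu : I ^ 2 + I * J + J ^ 2 = 1 := lreg_form_eq_one ha he hf hef (huIJ ▸ hu)
  have nv : I' ^ 2 + I' * J' + J' ^ 2 = 1 := lreg_form_eq_one ha he hf hef (hvIJ ▸ hv)
  have huv' : 2 * (I * I') + I * J' + J * I' + 2 * (J * J') = 1 := by
    have h1 := lreg_inner_comb he hf hef (I : ℝ) J I' J'
    rw [← huIJ, ← hvIJ, huv] at h1
    have h2 : (2 * ((I : ℝ) * I') + I * J' + J * I' + 2 * (J * J')) = 1 := by
      have h3 := mul_left_cancel₀ (pow_ne_zero 2 ha.ne') (h1.symm.trans (mul_one_div _ _).symm)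
      linear_combination 2 * h3
    exact_mod_cast h2
  obtain ⟨hdet, hAB, hA0⟩ := lreg_sigma_det nu nv huv'
  obtain ⟨σ, hσ, ⟨i₀, hi₀⟩, ⟨j₀, hj₀⟩⟩ := lreg_choose_sign hmn hm0 hAB hA0
  -- the base point of the upper level in the frame `(u, v)`
  have hx : p + H • EuclideanSpace.single (2 : Fin 3) (1 : ℝ) =
      t₁ + (((i₂ + i₃ : ℤ) : ℝ) / 3) • e + (((j₂ + j₃ : ℤ) : ℝ) / 3) • f := by
    push_cast
    linear_combination (norm := module) (-1 / 3 : ℝ) • (C1 - ht₂ - ht₃)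
  have ho : p + H • EuclideanSpace.single (2 : Fin 3) (1 : ℝ) + (σ : ℝ) • ((1 / 3 : ℝ) • (u + v)) =
      t₁ + (i₀ : ℝ) • e + (j₀ : ℝ) • f := by
    rw [hx, huIJ, hvIJ]
    have hi₀R : ((i₂ + i₃ : ℤ) : ℝ) + σ * (I + I') = 3 * i₀ := by exact_mod_cast hi₀
    have hj₀R : ((j₂ + j₃ : ℤ) : ℝ) + σ * (J + J') = 3 * j₀ := by exact_mod_cast hj₀
    linear_combination (norm := module) ((1 / 3 : ℝ) * hi₀R) • e + ((1 / 3 : ℝ) * hj₀R) • f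
  refine ⟨σ, by rcases hσ with rfl | rfl <;> simp, ?_⟩
  calc {q ∈ X | q 2 = p 2 + H}
      = {q ∈ X | q 2 = t₁ 2} := by rw [h₁]
    _ = {q | ∃ i j : ℤ, q = t₁ + (i : ℝ) • e + (j : ℝ) • f} := hL
    _ = {q | ∃ i j : ℤ, q = p + H • EuclideanSpace.single (2 : Fin 3) (1 : ℝ) +
          (σ : ℝ) • ((1 / 3 : ℝ) • (u + v)) + (i : ℝ) • e + (j : ℝ) • f} := lreg_rebase ho
    _ = _ := lreg_unimodular huIJ hvIJ hdet


/-! ## Main theorem -/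

/-- STUB E0b2 (exact inter-level rigidity): with all levels triangular lattices of spacing `a`,
heights pairwise equal or `≥ 19/25` apart, and three points at distance `b` on one height above
and one below every point, the levels at heights `p 2 ± h`, `h = √(b² − a²/3)`, are
`p ± h e₃ + σ w + ℤu + ℤv` (`w = (u + v)/3`, `σ = ±1`), and no height of `X` lies strictly
within `h` of `p 2` except `p 2` itself. -/
theorem stub_levelRegistry (X : Set (EuclideanSpace ℝ (Fin 3))) (a b : ℝ) (ha1 : 19 / 20 ≤ a)
    (_ha2 : a ≤ 1) (hb1 : 19 / 20 ≤ b) (hb2 : b ≤ 1)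
    (_hsep : ∀ p ∈ X, ∀ q ∈ X, p ≠ q → 19 / 20 ≤ dist p q)
    (hgap : ∀ p ∈ X, ∀ q ∈ X, q 2 = p 2 ∨ 19 / 25 ≤ |q 2 - p 2|)
    (hlat : ∀ p ∈ X, ∃ u v : EuclideanSpace ℝ (Fin 3), u 2 = 0 ∧ v 2 = 0 ∧ ‖u‖ = a ∧ ‖v‖ = a ∧
      inner ℝ u v = a ^ 2 / 2 ∧
      {q ∈ X | q 2 = p 2} = {q | ∃ i j : ℤ, q = p + (i : ℝ) • u + (j : ℝ) • v})
    (hup : ∀ p ∈ X, ∃ g : ℝ, 0 < g ∧ ∃ F : Finset (EuclideanSpace ℝ (Fin 3)), F.card = 3 ∧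
      ∀ q ∈ F, q ∈ X ∧ q 2 = p 2 + g ∧ dist p q = b)
    (hdn : ∀ p ∈ X, ∃ g : ℝ, 0 < g ∧ ∃ F : Finset (EuclideanSpace ℝ (Fin 3)), F.card = 3 ∧
      ∀ q ∈ F, q ∈ X ∧ q 2 = p 2 - g ∧ dist p q = b)
    (p : EuclideanSpace ℝ (Fin 3)) (hp : p ∈ X) (u v : EuclideanSpace ℝ (Fin 3)) (hu2 : u 2 = 0)
    (hv2 : v 2 = 0) (hu : ‖u‖ = a) (hv : ‖v‖ = a) (huv : inner ℝ u v = a ^ 2 / 2)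
    (hlev : {q ∈ X | q 2 = p 2} = {q | ∃ i j : ℤ, q = p + (i : ℝ) • u + (j : ℝ) • v}) :
    ∃ σ τ : ℝ, (σ = 1 ∨ σ = -1) ∧ (τ = 1 ∨ τ = -1) ∧
      {q ∈ X | q 2 = p 2 + Real.sqrt (b ^ 2 - a ^ 2 / 3)} =
        {q | ∃ i j : ℤ, q = p + Real.sqrt (b ^ 2 - a ^ 2 / 3) •
          EuclideanSpace.single (2 : Fin 3) (1 : ℝ) +
          σ • ((1 / 3 : ℝ) • (u + v)) + (i : ℝ) • u + (j : ℝ) • v} ∧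
      {q ∈ X | q 2 = p 2 - Real.sqrt (b ^ 2 - a ^ 2 / 3)} =
        {q | ∃ i j : ℤ, q = p - Real.sqrt (b ^ 2 - a ^ 2 / 3) •
          EuclideanSpace.single (2 : Fin 3) (1 : ℝ) +
          τ • ((1 / 3 : ℝ) • (u + v)) + (i : ℝ) • u + (j : ℝ) • v} ∧
      ∀ q ∈ X, |q 2 - p 2| < Real.sqrt (b ^ 2 - a ^ 2 / 3) → q 2 = p 2 := by
  -- the up- and down-data in signed form
  have hud1 : ∀ y ∈ X, ∃ g : ℝ, 0 < g ∧ ∃ F : Finset (EuclideanSpace ℝ (Fin 3)), F.card = 3 ∧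
      ∀ q ∈ F, q ∈ X ∧ q 2 = y 2 + 1 * g ∧ dist y q = b := by
    intro y hy
    obtain ⟨g, hg, F, hF, hq⟩ := hup y hy
    exact ⟨g, hg, F, hF, fun q hqF => by simpa only [one_mul] using hq q hqF⟩
  have hud2 : ∀ y ∈ X, ∃ g : ℝ, 0 < g ∧ ∃ F : Finset (EuclideanSpace ℝ (Fin 3)), F.card = 3 ∧
      ∀ q ∈ F, q ∈ X ∧ q 2 = y 2 + (-1) * g ∧ dist y q = b := by
    intro y hy
    obtain ⟨g, hg, F, hF, hq⟩ := hdn y hy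
    exact ⟨g, hg, F, hF, fun q hqF => by simpa only [neg_one_mul, ← sub_eq_add_neg] using hq q hqF⟩
  obtain ⟨σ, hσ, hLσ⟩ := lreg_level ha1 hb2 (Or.inl rfl) hgap hlat hud1 hp hu2 hv2 hu hv huv hlev
  obtain ⟨τ, hτ, hLτ⟩ := lreg_level ha1 hb2 (Or.inr rfl) hgap hlat hud2 hp hu2 hv2 hu hv huv hlev
  simp only [one_mul] at hLσ
  simp only [neg_one_mul, neg_smul, ← sub_eq_add_neg] at hLτ
  refine ⟨σ, τ, hσ, hτ, hLσ, hLτ, ?_⟩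
  -- no intermediate heights
  set h0 := Real.sqrt (b ^ 2 - a ^ 2 / 3) with hh0
  have hh1 : h0 ≤ 1 := Real.sqrt_le_one.2 (by nlinarith)
  have hq₁ : p + h0 • EuclideanSpace.single (2 : Fin 3) (1 : ℝ) + σ • ((1 / 3 : ℝ) • (u + v)) ∈
      {q ∈ X | q 2 = p 2 + h0} := by
    rw [hLσ]; exact ⟨0, 0, by simp⟩
  have hq₂ : p - h0 • EuclideanSpace.single (2 : Fin 3) (1 : ℝ) + τ • ((1 / 3 : ℝ) • (u + v)) ∈
      {q ∈ X | q 2 = p 2 - h0} := by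
    rw [hLτ]; exact ⟨0, 0, by simp⟩
  obtain ⟨h₁X, h₁⟩ := hq₁
  obtain ⟨h₂X, h₂⟩ := hq₂
  intro q hq hlt
  rcases hgap p hp q hq with h | h
  · exact h
  exfalso
  rcases le_or_gt 0 (q 2 - p 2) with hpos | hneg
  · rw [abs_of_nonneg hpos] at h hlt
    rcases hgap _ h₁X q hq with h' | h'
    · rw [h₁] at h'; linarith
    · rw [h₁, abs_of_nonpos (by linarith)] at h'; linarith
  · rw [abs_of_neg hneg] at h hlt
    rcases hgap _ h₂X q hq with h' | h'
    · rw [h₂] at h'; linarith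
    · rw [h₂, abs_of_nonneg (by linarith)] at h'; linarith

end Summit.AtomisticToContinuum.Crystallization.Theorems.PeriodicWindowsSketch
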